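import Summits.KontsevichZagierPeriods.KontsevichZagierPeriods.Theorems.SoloBlindLine
import HarnessLib

/-!
# Subgraphs: the Newton–Leibniz move from a planar region to the line

The one move of rule (3) used by every two-dimensional ℚ-rational representation of this series
(`SoloBlindLemniscateReps`, `SoloBlindFermatCubic`): if `σ = {(x,y) | 0 < x < 1, 0 ≤ y ≤ β(x)}` is
the region under the graph of `β ≥ 0` and `r = [σ, 1]`, then `[r] ≡ [(0,1), β]` by ONE
Newton–Leibniz move with primitive `y` (`subgraph_sub_lineRep`). Also: the constant `1` is
integrable on any region inside the unit square (`integrableOn_one_of_subset_Icc`), and regions cut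
out of the strip `0 < x < 1, 0 ≤ y` by one polynomial inequality are `ℚ`-semialgebraic
(`isSemialgebraic_subgraph`).
-/

noncomputable section

namespace Summit.KontsevichZagierPeriods.KontsevichZagierPeriods.Theorems

open Set MeasureTheory
open Literature.ModelTheory.ExponentialFields (IsSemialgebraic isSemialgebraic_setOf_eval_pos
  isSemialgebraic_setOf_eval_lt isSemialgebraic_setOf_eval_nonneg isSemialgebraic_setOf_eval_le)
open MvPolynomial (aeval X)
open Literature.NumberTheory.Transcendental
open Literature.NumberTheory.Transcendental.KZ

namespace SoloBlind

/-- A region of the strip `0 < x < 1`, `0 ≤ y` cut out by one polynomial inequality `p ≤ q` is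
`ℚ`-semialgebraic. -/
theorem isSemialgebraic_subgraph (p q : MvPolynomial (Fin 2) ℚ) :
    IsSemialgebraic ℚ {z : Fin 2 → ℝ | (0 < z 0 ∧ z 0 < 1) ∧ 0 ≤ z 1 ∧ aeval z p ≤ aeval z q} := by
  have h0 := isSemialgebraic_setOf_eval_pos (R := ℝ) (X 0 : MvPolynomial (Fin 2) ℚ)
  have h1 := isSemialgebraic_setOf_eval_lt (R := ℝ) (X 0 : MvPolynomial (Fin 2) ℚ) 1
  have h2 := isSemialgebraic_setOf_eval_nonneg (R := ℝ) (X 1 : MvPolynomial (Fin 2) ℚ)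
  have h3 := isSemialgebraic_setOf_eval_le (R := ℝ) p q
  convert ((h0.inter h1).inter h2).inter h3 using 1
  ext z
  simp [and_assoc]

/-- The constant `1` is integrable on any region inside the unit square. -/
theorem integrableOn_one_of_subset_Icc {σ : Set (Fin 2 → ℝ)} (h : σ ⊆ Icc 0 1) :
    IntegrableOn (fun _ : Fin 2 → ℝ => (1 : ℝ)) σ :=
  integrableOn_const ((measure_mono h).trans_lt measure_Icc_lt_top).ne

/-- A region of the strip with `y ≤ 1` lies inside the unit square. -/
theorem subset_Icc_of_le_one {σ : Set (Fin 2 → ℝ)}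
    (h : ∀ z ∈ σ, (0 < z 0 ∧ z 0 < 1) ∧ 0 ≤ z 1 ∧ z 1 ≤ 1) : σ ⊆ Icc 0 1 := fun z hz => by
  obtain ⟨⟨h0, h1⟩, h2, h3⟩ := h z hz
  refine ⟨fun i => ?_, fun i => ?_⟩ <;> fin_cases i
  · exact h0.le
  · exact h2
  · exact h1.le
  · exact h3

/-- **Newton–Leibniz move for a subgraph over `(0,1)`.** If `β ≥ 0` is the integrand of a
representation `ρ = [(0,1), β]` and `r = [σ, 1]` with
`σ = {(x,y) | 0 < x < 1, 0 ≤ y ≤ β x}`, then `[r] - [ρ]` is ONE move of rule (3), primitive `y`. -/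
theorem subgraph_sub_lineRep (r : IntegralRep 2) {β : ℝ → ℝ}
    {hS : IsSemialgebraic ℚ (line (Ioo (0:ℝ) 1))}
    {hβ : IsSemialgebraicFunOn ℚ (line (Ioo (0:ℝ) 1)) (fun x => β (x 0))}
    {hi : IntegrableOn β (Ioo 0 1)} (hβ0 : ∀ x ∈ Ioo (0:ℝ) 1, 0 ≤ β x)
    (hdom : r.domain = {z | (0 < z 0 ∧ z 0 < 1) ∧ 0 ≤ z 1 ∧ z 1 ≤ β (z 0)})
    (hint : r.integrand = fun _ => 1) :
    of r - of (lineRep (Ioo 0 1) β hS hβ hi) ∈ relations := by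
  set ρ := lineRep (Ioo 0 1) β hS hβ hi with hρ
  set F : (Fin (1 + 1) → ℝ) → ℝ := fun z => z (Fin.last 1) with hF
  have hFsa : IsSemialgebraicFunOn ℚ r.domain F :=
    (isSemialgebraicFunOn_aeval r.isSemialgebraic_domain (X (Fin.last 1))).congr fun z _ => by
      simp [hF]
  have hasa : IsSemialgebraicFunOn ℚ ρ.domain (fun _ => (0:ℝ)) :=
    isSemialgebraicFunOn_const_of_isAlgebraic ρ.isSemialgebraic_domain isAlgebraic_zero
  have hbsa : IsSemialgebraicFunOn ℚ ρ.domain (fun x => β (x 0)) := hβ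
  have hab : ∀ x ∈ ρ.domain, (fun _ => (0:ℝ)) x ≤ (fun x => β (x 0)) x := fun x hx => hβ0 _ hx
  have hband : r.domain = {z | (Fin.init z : Fin 1 → ℝ) ∈ ρ.domain ∧
      (fun _ => (0:ℝ)) (Fin.init z) ≤ z (Fin.last 1) ∧
      z (Fin.last 1) ≤ (fun x => β (x 0)) (Fin.init z)} := by
    rw [hdom]
    ext z
    simp only [mem_setOf_eq, hρ, lineRep_domain, mem_line, mem_Ioo, Fin.init, Fin.castSucc_zero,
      show (Fin.last 1 : Fin 2) = 1 from rfl]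
  have hcont : ∀ x ∈ ρ.domain, ContinuousOn (fun t : ℝ => F (Fin.snoc x t))
      (Icc ((fun _ => (0:ℝ)) x) ((fun x => β (x 0)) x)) := by
    intro x _
    simp only [hF, Fin.snoc_last]
    exact continuousOn_id
  have hder : ∀ x ∈ ρ.domain, ∀ t ∈ Ioo ((fun _ => (0:ℝ)) x) ((fun x => β (x 0)) x),
      HasDerivAt (fun s : ℝ => F (Fin.snoc x s)) (r.integrand (Fin.snoc x t)) t := by
    intro x _ t _
    simp only [hF, Fin.snoc_last, hint]
    exact hasDerivAt_id t
  have hval : ∀ x ∈ ρ.domain, ρ.integrand x =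
      F (Fin.snoc x ((fun x => β (x 0)) x)) - F (Fin.snoc x ((fun _ => (0:ℝ)) x)) := by
    intro x _
    simp only [hρ, lineRep_integrand, hF, Fin.snoc_last, sub_zero]
  exact newtonLeibnizRel_subset_relations ⟨1, r, ρ, fun _ => 0, fun x => β (x 0), F, hFsa, hasa,
    hbsa, hab, hband, hcont, hder, hval, rfl⟩

end SoloBlind

end Summit.KontsevichZagierPeriods.KontsevichZagierPeriods.Theorems
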